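import Summits.Ventures.YMGap.RobustBall.WilsonOneStateSymmetry
import Summits.Ventures.YMGap.RobustBall.MassGapOnBallS
import Summits.Ventures.YMGap.Thresholds.ImprovedThresholdStar
import Literature.Probability.LatticeModels.TailTrivialMixing
import Literature.MathematicalPhysics.QuantumFieldTheory.Balaban1983to89.T4AveragingDisintegration
import HarnessLib

/-!
# Venture YMGap, track ROBUST-BALL — ONE STATE, structure: the one state is TAIL TRIVIAL, has SHORT-RANGE CORRELATIONS
# for ALL events, and is ERGODIC under every lattice translation

HONEST FRAMING. WHAT THIS IS: a venture file (cell `pub-ymgap`, track Y2 ROBUST-BALL, seat ds-3, theorems only). The cell's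
mass-gap currencies (`MassGapAt`, `PerturbedMassGapAt`, `PerturbedMassGapAtS`) give ONE DLR state with exponential
clustering of LIPSCHITZ CYLINDER observables. This file adds the measure-theoretic structure that uniqueness alone forces,
through lit's extremal-decomposition machinery (`GibbsTailTriviality.lean`, Georgii Thm. 7.26; `TailTrivialMixing.lean`,
Georgii Prop. 7.9 / 14.9):
* `isTailTrivial_of_subsingleton` — ★ GENERIC (countable sites, standard Borel spins, any specification): if `𝒢(γ)` has at
  most one element then every `μ ∈ 𝒢(γ)` is TRIVIAL ON THE TAIL σ-ALGEBRA (`μ = ∫ π^ω dμ` with `π^ω ∈ 𝒢(γ) = {μ}` tail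
  trivial a.s.);
* `oneState_tailTrivial_of_massGapAt` — ★★ WILSON, every `d ≥ 1`, `N`: under `MassGapAt d N β` the one state `μ` is tail
  trivial, has SHORT-RANGE CORRELATIONS FOR ALL EVENTS (`∀ A, ∀ ε > 0, ∃ Λ finite, ∀ B ∈ 𝓕_{Λᶜ}: |μ(A ∩ B) − μ(A)μ(B)| ≤ ε`
  — not only for Lipschitz cylinders), and is ERGODIC under every non-zero lattice translation (`θ_v⁻¹ A = A ⇒ μ(A) ∈ {0,1}`);
* `oneState_tailTrivial_of_perturbedMassGapAt` / `…AtS` — tiers 1 and 2: tail triviality and short-range correlations of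
  the one state of every member; the `SU(2)` cell `su2_wilson_oneState_tailTrivial` (`|b| ≤ 9/50`).
WHAT THIS IS NOT: qualitative statements (no rate for general events — the rate is for Lipschitz observables,
`BoundaryDecay*.lean`); lattice only; nothing about the continuum limit or the Clay Millennium problem.

References: H.-O. Georgii, *Gibbs Measures and Phase Transitions* (2011), Thm. 7.7, Prop. 7.9, Thm. 7.26, Prop. 14.9; lit's
`GibbsTailTriviality.lean`, `TailTrivialMixing.lean`, `T4AveragingDisintegration.lean` (standard Borel `SU(N)`).
-/

noncomputable section

open MeasureTheory Filter Function ProbabilityTheory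
open Literature.Probability.LatticeModels hiding configShift configShift_apply
open Literature.Probability.Percolation (coordShift)
open Literature.MathematicalPhysics.QuantumLattice
open Literature.MathematicalPhysics.QuantumFieldTheory hiding ZdEdge Site

namespace Summit.Ventures.YMGap.RobustBall

/-! ### Generic: uniqueness ⇒ tail triviality -/

section Generic

variable {V S : Type*} [MeasurableSpace S] [Countable V] [StandardBorelSpace S]

/-- ★ **Uniqueness ⇒ tail triviality** (Georgii 2011, Thm. 7.7 with Thm. 7.26): if the specification `γ` (countable sites,
standard Borel spins) has at most one Gibbs measure, then every `μ ∈ 𝒢(γ)` is trivial on the tail σ-algebra. Proof: the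
conditional measures `π^ω = μ(· | 𝒯)(ω)` are Gibbs (`ae_isGibbsMeasure_condExpKernel_tail`), hence `= μ`, and tail trivial
(`ae_isTailTrivial_condExpKernel_tail`) for a.e. `ω`. [folklore] -/
theorem isTailTrivial_of_subsingleton {γ : Specification V S} (hγ : IsSpecification γ)
    (hsub : (gibbsMeasures γ).Subsingleton) {μ : Measure (V → S)} (hμ : μ ∈ gibbsMeasures γ) : IsTailTrivial μ := by
  have hμG : IsGibbsMeasure γ μ := hμ
  haveI := hμG.isProbabilityMeasure
  obtain ⟨ω, hω1, hω2⟩ :=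
    ((hμG.ae_isGibbsMeasure_condExpKernel_tail hγ).and (hμG.ae_isTailTrivial_condExpKernel_tail hγ)).exists
  have heq : condExpKernel μ (tailEvents V S) ω = μ := hsub hω1 hμ
  rw [← heq]
  exact hω2

end Generic

/-! ### Lattice translations of `ℤ^d` move finite link sets to infinity -/

section Shift

variable {d : ℕ} {G : Type*}

/-- The configuration translation `θ_v` is the coordinate shift by `e ↦ (e.1 − v, e.2)`. [folklore] -/
theorem coe_configShift_eq_coordShift [MeasurableSpace G] (v : Literature.Probability.LatticeModels.Site d) :
    ⇑(configShift (G := G) v) = coordShift (X := G) fun e : ZdEdge d => (e.1 - v, e.2) := by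
  funext U e
  rw [configShift_apply]
  rfl

/-- Iterating the link translation: `(e ↦ (e.1 − v, e.2))^[n] e = ((x ↦ x − v)^[n] e.1, e.2)`. [folklore] -/
theorem iterate_edgeSub_apply (v : Literature.Probability.LatticeModels.Site d) (n : ℕ) (e : ZdEdge d) :
    (fun e : ZdEdge d => (e.1 - v, e.2))^[n] e =
      ((fun y : Literature.Probability.LatticeModels.Site d => y - v)^[n] e.1, e.2) := by
  induction n generalizing e with
  | zero => rfl
  | succ n ih => rw [Function.iterate_succ_apply, ih, Function.iterate_succ_apply]

/-- A non-zero translation eventually moves every finite link set out of every finite link set (lit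
`exists_forall_iterate_sub_notMem` on base points). [folklore] -/
theorem exists_forall_iterate_edgeSub_notMem {v : Literature.Probability.LatticeModels.Site d} (hv : v ≠ 0)
    (s Λ : Finset (ZdEdge d)) : ∃ n : ℕ, ∀ e ∈ s, (fun e : ZdEdge d => (e.1 - v, e.2))^[n] e ∉ Λ := by
  classical
  obtain ⟨n, hn⟩ := exists_forall_iterate_sub_notMem hv (s.image Prod.fst) (Λ.image Prod.fst)
  refine ⟨n, fun e he hmem => ?_⟩
  rw [iterate_edgeSub_apply] at hmem
  exact hn e.1 (Finset.mem_image_of_mem _ he) (Finset.mem_image.2 ⟨_, hmem, rfl⟩)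

end Shift

/-! ### Wilson, every `d ≥ 1`, `N`: the one state is tail trivial, short-range, ergodic -/

section Wilson

variable {d N : ℕ}

/-- ★★ **UNDER `MassGapAt d N β` THE ONE STATE IS TAIL TRIVIAL, HAS SHORT-RANGE CORRELATIONS FOR ALL EVENTS, AND IS ERGODIC UNDER
EVERY NON-ZERO LATTICE TRANSLATION.** There is `μ` with `ymGibbsMeasures = {μ}`, trivial on the tail σ-algebra (Georgii Thm. 7.7);
for every event `A` and `ε > 0` a finite link set `Λ` with `|μ(A ∩ B) − μ(A) μ(B)| ≤ ε` for every event `B` determined off `Λ`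
(Georgii Prop. 7.9); and `μ(A) ∈ {0, 1}` for every event invariant under a translation `θ_v`, `v ≠ 0` (Georgii Prop. 14.9).
[folklore] -/
theorem oneState_tailTrivial_of_massGapAt [NeZero d] {β : ℝ} (hgap : MassGapAt d N β) :
    ∃ μ : Measure (LGConfig d (SUN N)),
      ymGibbsMeasures (d := d) (fundamentalRep (Fin N)) ((N : ℝ) * β) = {μ} ∧ IsTailTrivial μ ∧
      (∀ A : Set (LGConfig d (SUN N)), MeasurableSet A → ∀ ε : ℝ, 0 < ε →
        ∃ Λ : Finset (ZdEdge d), ∀ B : Set (LGConfig d (SUN N)),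
          MeasurableSet[cylinderEvents (X := fun _ : ZdEdge d => SUN N) ((↑Λ : Set (ZdEdge d))ᶜ)] B →
            |μ.real (A ∩ B) - μ.real A * μ.real B| ≤ ε) ∧
      ∀ v : Literature.Probability.LatticeModels.Site d, v ≠ 0 → ∀ A : Set (LGConfig d (SUN N)), MeasurableSet A →
        (configShift v) ⁻¹' A = A → μ A = 0 ∨ μ A = 1 := by
  obtain ⟨hsub, -⟩ := hgap.1
  obtain ⟨μ, hG, hT⟩ := oneState_translationInvariant_of_massGapAt hgap
  have hμ : μ ∈ ymGibbsMeasures (d := d) (fundamentalRep (Fin N)) ((N : ℝ) * β) := by rw [hG]; exact Set.mem_singleton μ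
  have hμG : IsGibbsMeasure (ymSpecification (d := d) (fundamentalRep (Fin N)) ((N : ℝ) * β)) μ := hμ
  haveI := hμG.isProbabilityMeasure
  have htail : IsTailTrivial μ :=
    isTailTrivial_of_subsingleton (isSpecification_ymSpecification_of_t2Space (d := d) _ (continuous_fundamentalRep (Fin N)) _)
      hsub hμ
  refine ⟨μ, hG, htail, fun A hA ε hε => htail.exists_finset_abs_measureReal_inter_sub_le hA hε, fun v hv A hA hinv => ?_⟩
  have hpres : MeasurePreserving (coordShift (X := SUN N) fun e : ZdEdge d => (e.1 - v, e.2)) μ μ := by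
    rw [← coe_configShift_eq_coordShift]
    exact ⟨(configShift v).measurable, hT v⟩
  rw [coe_configShift_eq_coordShift] at hinv
  exact htail.measure_eq_zero_or_one_of_preimage_coordShift_eq hpres (exists_forall_iterate_edgeSub_notMem hv) hA hinv

/-- ★ **`SU(2)` on `ℤ⁴`, TWO-SIDED, every `|b| ≤ 9/50`** (tree coupling `b`; Wilson `|β_W| ≤ 9/25`): the one state is tail trivial,
short-range for all events, and ergodic under every non-zero translation. [folklore] -/
theorem su2_wilson_oneState_tailTrivial {b : ℝ} (h : |b| ≤ 9 / 50) :
    ∃ μ : Measure (LGConfig 4 (SUN 2)),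
      ymGibbsMeasures (d := 4) (fundamentalRep (Fin 2)) b = {μ} ∧ IsTailTrivial μ ∧
      (∀ A : Set (LGConfig 4 (SUN 2)), MeasurableSet A → ∀ ε : ℝ, 0 < ε →
        ∃ Λ : Finset (ZdEdge 4), ∀ B : Set (LGConfig 4 (SUN 2)),
          MeasurableSet[cylinderEvents (X := fun _ : ZdEdge 4 => SUN 2) ((↑Λ : Set (ZdEdge 4))ᶜ)] B →
            |μ.real (A ∩ B) - μ.real A * μ.real B| ≤ ε) ∧
      ∀ v : Literature.Probability.LatticeModels.Site 4, v ≠ 0 → ∀ A : Set (LGConfig 4 (SUN 2)), MeasurableSet A →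
        (configShift v) ⁻¹' A = A → μ A = 0 ∨ μ A = 1 := by
  have hm := ImprovedThresholdStar.su2_massGapAt_of_abs_le (β := b / 2) (by rw [abs_div, abs_two]; linarith)
  have e : (((2 : ℕ) : ℝ)) * (b / 2) = b := by push_cast; ring
  have h := oneState_tailTrivial_of_massGapAt hm
  rwa [e] at h

end Wilson

/-! ### Tiers 1 and 2: the one state of every member is tail trivial and short-range -/

section Members

variable {d N : ℕ}

/-- ★ **TIER 1: under `PerturbedMassGapAt d N β W supp` (continuous terms reading their own links, locally finite support) the one state is tail
trivial and has short-range correlations for all events.** [folklore] -/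
theorem oneState_tailTrivial_of_perturbedMassGapAt {β : ℝ} {W : Potential (ZdEdge d) (SUN N)}
    {supp : Finset (ZdEdge d) → Finset (Finset (ZdEdge d))} (hgap : PerturbedMassGapAt d N β W supp)
    (hWc : ∀ X, Continuous (W X)) (hdep : ∀ X, DependsOn (W X) (↑X : Set (ZdEdge d))) (hsupp : W.IsSupportedBy supp) :
    ∃ μ : Measure (LGConfig d (SUN N)),
      perturbedGibbsMeasures (d := d) (fundamentalRep (Fin N)) ((N : ℝ) * β) W supp = {μ} ∧ IsTailTrivial μ ∧
      ∀ A : Set (LGConfig d (SUN N)), MeasurableSet A → ∀ ε : ℝ, 0 < ε →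
        ∃ Λ : Finset (ZdEdge d), ∀ B : Set (LGConfig d (SUN N)),
          MeasurableSet[cylinderEvents (X := fun _ : ZdEdge d => SUN N) ((↑Λ : Set (ZdEdge d))ᶜ)] B →
            |μ.real (A ∩ B) - μ.real A * μ.real B| ≤ ε := by
  obtain ⟨hsub, ⟨μ, hμ⟩⟩ := hgap.1
  have hμG : IsGibbsMeasure (perturbedYM (d := d) (fundamentalRep (Fin N)) ((N : ℝ) * β) W supp) μ := hμ
  haveI := hμG.isProbabilityMeasure
  have hγ : IsSpecification (perturbedYM (d := d) (fundamentalRep (Fin N)) ((N : ℝ) * β) W supp) :=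
    isSpecification_perturbedYM _ (continuous_fundamentalRep (Fin N)) _ (fun X => ⟨hdep X, (hWc X).measurable⟩)
      (fun X => exists_bound_of_continuous (hWc X)) hsupp
  have htail : IsTailTrivial μ := isTailTrivial_of_subsingleton hγ hsub hμ
  exact ⟨μ, Set.eq_singleton_iff_unique_mem.2 ⟨hμ, fun ν hν => hsub hν hμ⟩, htail,
    fun A hA ε hε => htail.exists_finset_abs_measureReal_inter_sub_le hA hε⟩

/-- ★ **TIER 2: under `PerturbedMassGapAtS d N β W` (summable majorant, continuous own-link terms) the one state is tail trivial
and has short-range correlations for all events.** [folklore] -/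
theorem oneState_tailTrivial_of_perturbedMassGapAtS {β : ℝ} {W : Potential (ZdEdge d) (SUN N)} {B₀ : Finset (ZdEdge d) → ℝ}
    (hgap : PerturbedMassGapAtS d N β W) (h : IsLinkSummable W B₀) (hWc : ∀ X, Continuous (W X))
    (hWdep : ∀ X, DependsOn (W X) (↑X : Set (ZdEdge d))) :
    ∃ μ : Measure (LGConfig d (SUN N)),
      perturbedGibbsMeasuresS (d := d) (fundamentalRep (Fin N)) ((N : ℝ) * β) W = {μ} ∧ IsTailTrivial μ ∧
      ∀ A : Set (LGConfig d (SUN N)), MeasurableSet A → ∀ ε : ℝ, 0 < ε →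
        ∃ Λ : Finset (ZdEdge d), ∀ B : Set (LGConfig d (SUN N)),
          MeasurableSet[cylinderEvents (X := fun _ : ZdEdge d => SUN N) ((↑Λ : Set (ZdEdge d))ᶜ)] B →
            |μ.real (A ∩ B) - μ.real A * μ.real B| ≤ ε := by
  obtain ⟨hsub, ⟨μ, hμ⟩⟩ := hgap.1
  have hμG : IsGibbsMeasure (perturbedYMS (d := d) (fundamentalRep (Fin N)) ((N : ℝ) * β) W) μ := hμ
  haveI := hμG.isProbabilityMeasure
  have hγ : IsSpecification (perturbedYMS (d := d) (fundamentalRep (Fin N)) ((N : ℝ) * β) W) :=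
    isSpecification_perturbedYMS _ (continuous_fundamentalRep (Fin N)) _ h hWc hWdep
  have htail : IsTailTrivial μ := isTailTrivial_of_subsingleton hγ hsub hμ
  exact ⟨μ, Set.eq_singleton_iff_unique_mem.2 ⟨hμ, fun ν hν => hsub hν hμ⟩, htail,
    fun A hA ε hε => htail.exists_finset_abs_measureReal_inter_sub_le hA hε⟩

end Members

end Summit.Ventures.YMGap.RobustBall

end
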